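import Literature.MathematicalPhysics.QuantumFieldTheory.Balaban1983to89.B5Local114G0First

/-!
# `Balaban1983to89.B5Local114G0Second` — the localized L² bound (1.114) FOR G₀ ON THE TORUS, second-order entry:
# `‖ζ∇∇G₀J‖ ≤ O(1)e^{−δ₀|y−y′|}|ζ|‖J‖` (supp ζ ⊂ Δ̃(y), supp J ⊂ Δ̃(y′)), by the p. 36 «simplest proof» route plus a WEIGHTED
# form of the torus identity `Σ_{λλ′}‖∂_λ∂_λ′φ‖² = ‖Δφ‖²`

statement-level skeleton of published theorems with citation tags; proofs where landed; nothing here is a claim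
about the Yang–Mills mass gap

Source (lit-balaban cell, Phase-2 proof seat p38 gen 5): T. Bałaban, *Propagators and renormalization transformations
for lattice gauge theories. I*, Commun. Math. Phys. **95** (1984) 17–40 [`Balaban1984PropagatorsI`, "B5"], pp. 35–36
[PDF 19–20] ((1.114)), p. 36 (the route), p. 39 [PDF 23] (G₀), p. 21 [PDF 5] (Δ); held as
`paper:balaban1984-cmp95-propagators-rt-i`.

## WHAT IS PRINTED (verbatim)

p. 36 [PDF 20], (1.114): «Finally there exists a constant O(1) such that ‖ζGJ‖, ‖ζ∇GJ‖, ‖ζG∇*J‖, ‖ζ∇G∇*J‖, ‖ζ∇∇GJ‖,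
‖ζG∇*∇*J‖ ≤ O(1)e^{−δ₀|y−y′|}|ζ|‖J‖ (1.114) for supp ζ ⊂ Δ̃(y), supp J ⊂ Δ̃(y′).»
p. 36: «Probably the simplest proof of the exponential decay properties can be obtained by … proving that the operator
e^{−⟨q,x⟩}Δ_a e^{⟨q,x⟩} − Δ_a is a small perturbation of Δ_a for vectors q ∈ R^d sufficiently small.»
p. 21 [PDF 5], (1.21): «where Δ is η-lattice Laplace operator for scalar functions».

## WHAT THIS MODULE PROVES (kernel-checked, zero sorry)

§1 torus calculus of the forward derivatives ∂_λ = `deriv P 0 η λ` (η = L^{−k}): the transpose ∂ᵀ_λ as a backward difference,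
   commutation ∂_λ∂_λ′ = ∂_λ′∂_λ and ∂ᵀ_λ∂_λ′ = ∂_λ′∂ᵀ_λ, hence Δ∂_λ′ = ∂_λ′Δ for Δ = Σ_λ∂ᵀ_λ∂_λ (`lap_deriv_comm`);
   product rules with a weight ω for ∂ and ∂ᵀ.
§2 THE WEIGHTED SECOND-ORDER INEQUALITY (`weighted_second_order`): for ω = e^{2δρ}, ρ `distX`-Lipschitz, 8δ ≤ 1, every φ
   and every pair (λ, λ′): `Σ_x ω(∂_λ∂_λ′φ)² ≤ 4·Σ_x ω(Δφ)² + 160·d·δ²·Σ_λ Σ_x ω(∂_λφ)²` — summation by parts in which ω is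
   differentiated only ONCE (so the Lipschitz weight suffices), the first-order terms absorbed by AM–GM.
§3 the entry: for v = G₀g (G₀ = `B5Eq133G0Torus.G0 P a m² k μ`), Δv = g − (Lᵏε)²m²v − aQ*_μQ_μv, the weighted norms of
   the three terms are controlled by `B5CombesThomasTorus.solve_bound`/`mass_bound` and the conjugated averaging
   (`nsq_wt_QvTQv_le`), whence `‖e^{δρ}∂_λ∂_λ′G₀g‖² ≤ K₄²‖e^{δρ}g‖²` (`nsq_wt_ddG0_le`) and the two-cut-off bound
   `cut_ddG0_sq_le`; packaged as **`opL2loc_four_le`**: (1.114), n = 4, for the G₀-settings of `B5G0SettingTorus`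
   (n = 5 is `:= 0` there, `opL2loc_five_le`).

## HONEST SCOPE / DIVERGENCE

Method = exponential conjugation (p. 36 alternative), NOT the random walk (1.118)–(1.131); the torus identity
Σ‖∂∂φ‖² = ‖Δφ‖² (commuting translations) replaces the elliptic-regularity step one would use on ηZ^d.  Constants depend on
(d, a, γ₀) only, not optimised.  CELL BOOK-KEEPING (lit-balaban): row B5.Prop1.2 census (vi) «h114G0» (owner r02,
referee ref-4); VALUE = the fifth L² bound of (1.114) for Bałaban's concrete G₀ on the torus — NOT summit progress.
-/

namespace Literature.MathematicalPhysics.QuantumFieldTheory.Balaban1983to89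

open Matrix Finset

noncomputable section

namespace B5Local114G0Second

open B1RG242Torus B5Ineq137Torus B5GpSettingTorus B5Eq133G0Torus B5G0SettingTorus B5Pieces133Torus
  B5Display136Torus B5CombesThomasTorus B5Local114G0First

variable {P : Params} {k : ℕ}

/-! ## §1 Torus calculus of ∂_λ, ∂ᵀ_λ, Δ -/

section Calculus

variable (s : ℝ)

/-- `(∂ᵀ_λψ)(x) = s⁻¹(ψ(x − e_λ) − ψ(x))` (every site has exactly one predecessor on the torus).
[cite: Balaban1984PropagatorsI, (1.21) p.21 («∂* is the divergence operator»)] -/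
theorem derivT_mulVec (lam : Fin P.d) (ψ : Site P 0 → ℝ) (x : Site P 0) :
    ((deriv P 0 s lam)ᵀ *ᵥ ψ) x = s⁻¹ * (ψ (Site.unshift x lam) - ψ x) := by
  have hS : ((shiftMat P 0 lam)ᵀ *ᵥ ψ) x = ψ (Site.unshift x lam) := by
    simp only [Matrix.mulVec, dotProduct, Matrix.transpose_apply, shiftMat, ite_mul, one_mul, zero_mul]
    simp_rw [eq_shift_iff x _ lam]
    rw [Finset.sum_ite_eq', if_pos (Finset.mem_univ _)]
  unfold B1RG242Torus.deriv
  simp only [Matrix.transpose_smul, Matrix.transpose_sub, Matrix.transpose_one, Matrix.smul_mulVec,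
    Matrix.sub_mulVec, Matrix.one_mulVec, Pi.smul_apply, Pi.sub_apply, hS, smul_eq_mul]

/-- unit shifts in two directions commute. [cite: Balaban1984PropagatorsI, (1.21) p.21] -/
theorem shift_shift_comm (x : Site P 0) (lam lam' : Fin P.d) :
    Site.shift (Site.shift x lam) lam' = Site.shift (Site.shift x lam') lam := by
  by_cases h : lam = lam'
  · subst h; rfl
  · funext ν
    simp only [Site.shift]
    by_cases h1 : ν = lam
    · subst h1; simp [Function.update_self, Function.update_of_ne h]
    · by_cases h2 : ν = lam'
      · subst h2; simp [Function.update_self, Function.update_of_ne (Ne.symm h)]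
      · simp [Function.update_of_ne h1, Function.update_of_ne h2]

/-- a backward shift commutes with a forward shift in another (or the same) direction. [cite: Balaban1984PropagatorsI, (1.21) p.21] -/
theorem unshift_shift_comm (x : Site P 0) (lam lam' : Fin P.d) :
    Site.unshift (Site.shift x lam') lam = Site.shift (Site.unshift x lam) lam' := by
  by_cases h : lam = lam'
  · subst h; rw [unshift_shift, shift_unshift]
  · funext ν
    simp only [Site.shift, Site.unshift]
    by_cases h1 : ν = lam
    · subst h1; simp [Function.update_self, Function.update_of_ne h]
    · by_cases h2 : ν = lam'
      · subst h2; simp [Function.update_self, Function.update_of_ne (Ne.symm h)]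
      · simp [Function.update_of_ne h1, Function.update_of_ne h2]

/-- **∂_λ∂_λ′ = ∂_λ′∂_λ** on functions. [cite: Balaban1984PropagatorsI, (1.21) p.21] -/
theorem deriv_deriv_comm (lam lam' : Fin P.d) (φ : Site P 0 → ℝ) :
    deriv P 0 s lam *ᵥ (deriv P 0 s lam' *ᵥ φ) = deriv P 0 s lam' *ᵥ (deriv P 0 s lam *ᵥ φ) := by
  funext x
  simp only [deriv_mulVec]
  rw [shift_shift_comm x lam lam']
  ring

/-- **∂ᵀ_λ∂_λ′ = ∂_λ′∂ᵀ_λ** on functions. [cite: Balaban1984PropagatorsI, (1.21) p.21] -/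
theorem derivT_deriv_comm (lam lam' : Fin P.d) (φ : Site P 0 → ℝ) :
    (deriv P 0 s lam)ᵀ *ᵥ (deriv P 0 s lam' *ᵥ φ) = deriv P 0 s lam' *ᵥ ((deriv P 0 s lam)ᵀ *ᵥ φ) := by
  funext x
  simp only [deriv_mulVec, derivT_mulVec]
  rw [unshift_shift_comm x lam lam']
  ring

variable (P) in
/-- **Δφ = Σ_λ ∂ᵀ_λ∂_λφ** (the η-lattice Laplace operator, = `lapEta P k` for s = L^{−k}; positive sign convention).
[cite: Balaban1984PropagatorsI, (1.21) p.21] -/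
def lap (s : ℝ) (φ : Site P 0 → ℝ) : Site P 0 → ℝ := ∑ lam, (deriv P 0 s lam)ᵀ *ᵥ (deriv P 0 s lam *ᵥ φ)

/-- `lapEta P k *ᵥ φ = lap φ` (η = L^{−k}). [cite: Balaban1984PropagatorsI, (1.21) p.21] -/
theorem lapEta_mulVec (φ : Site P 0 → ℝ) : lapEta P k *ᵥ φ = lap P ((P.L : ℝ) ^ k)⁻¹ φ := by
  rw [lapEta_eq, hOp_mulVec, zero_smul, zero_add, lap]

/-- **Δ∂_λ′ = ∂_λ′Δ** (translations commute). [cite: Balaban1984PropagatorsI, (1.21) p.21] -/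
theorem lap_deriv_comm (lam' : Fin P.d) (φ : Site P 0 → ℝ) :
    lap P s (deriv P 0 s lam' *ᵥ φ) = deriv P 0 s lam' *ᵥ lap P s φ := by
  unfold lap
  rw [Matrix.mulVec_sum]
  refine sum_congr rfl fun lam _ => ?_
  rw [deriv_deriv_comm s lam lam', derivT_deriv_comm]

/-- adjointness: `(∂ᵀ_λ g)·h = g·(∂_λ h)`. [cite: Balaban1984PropagatorsI, (1.21) p.21] -/
theorem derivT_dot (lam : Fin P.d) (g h : Site P 0 → ℝ) :
    ((deriv P 0 s lam)ᵀ *ᵥ g) ⬝ᵥ h = g ⬝ᵥ (deriv P 0 s lam *ᵥ h) := by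
  rw [Matrix.dotProduct_mulVec, Matrix.mulVec_transpose]

/-- product rule for the transpose: `∂ᵀ(ω·h)(x) = ω(x)(∂ᵀh)(x) + s⁻¹(ω(x − e) − ω(x))·h(x − e)`.
[cite: Balaban1984PropagatorsI, (1.21) p.21] -/
theorem derivT_pmul (lam : Fin P.d) (ω h : Site P 0 → ℝ) (x : Site P 0) :
    ((deriv P 0 s lam)ᵀ *ᵥ pmul ω h) x
      = ω x * ((deriv P 0 s lam)ᵀ *ᵥ h) x + s⁻¹ * (ω (Site.unshift x lam) - ω x) * h (Site.unshift x lam) := by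
  simp only [derivT_mulVec, pmul_apply]; ring

/-- sums over the torus are invariant under one backward shift. [cite: Balaban1984PropagatorsI, (1.21) p.21] -/
theorem sum_unshift (lam : Fin P.d) (f : Site P 0 → ℝ) : ∑ x, f (Site.unshift x lam) = ∑ x, f x := by
  have h := sum_shift (P := P) lam (fun x => f (Site.unshift x lam))
  simp only [unshift_shift] at h
  exact h.symm

end Calculus

/-! ## §2 The weighted second-order inequality -/

section Weighted

variable {ρ : Site P 0 → ℝ} {δ : ℝ}

/-- the squared weight ω = e^{2δρ} = (e^{δρ})². [cite: Balaban1984PropagatorsI, p.36 («e^{⟨q,x⟩}»)] -/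
theorem wt_two_mul (δ : ℝ) (ρ : Site P 0 → ℝ) (x : Site P 0) : wt P (2 * δ) ρ x = wt P δ ρ x ^ 2 := by
  rw [wt, wt, ← Real.exp_nat_mul]; ring_nf

/-- weight facts along one fine step for ω = e^{2δρ} (ρ Lipschitz, 0 ≤ δ, 8δ ≤ 1): `ω(x+e) ≤ (3/2)ω(x)`, `ω(x) ≤ (3/2)ω(x+e)`,
`|η⁻¹(ω(x+e) − ω(x))| ≤ 4δω(x)`. [cite: Balaban1984PropagatorsI, p.36] -/
theorem omega_step (hρ : LipX P k ρ) (hδ0 : 0 ≤ δ) (hδ8 : 8 * δ ≤ 1) (x : Site P 0) (lam : Fin P.d) :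
    wt P (2 * δ) ρ (Site.shift x lam) ≤ 3 / 2 * wt P (2 * δ) ρ x ∧
      wt P (2 * δ) ρ x ≤ 3 / 2 * wt P (2 * δ) ρ (Site.shift x lam) ∧
      |(((P.L : ℝ) ^ k)⁻¹)⁻¹ * (wt P (2 * δ) ρ (Site.shift x lam) - wt P (2 * δ) ρ x)| ≤ 4 * δ * wt P (2 * δ) ρ x := by
  have h2δ0 : 0 ≤ 2 * δ := by linarith
  have h2δ4 : 4 * (2 * δ) ≤ 1 := by linarith
  obtain ⟨h1, h3⟩ := wt_step_bounds hρ h2δ0 h2δ4 x lam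
  obtain ⟨h1', -⟩ := wt_step_bounds hρ.neg h2δ0 h2δ4 x lam
  refine ⟨h1, ?_, by linarith [h3]⟩
  -- from the −ρ version: ω(x+e)⁻¹ ≤ (3/2) ω(x)⁻¹
  rw [← wt_inv, ← wt_inv] at h1'
  have hp := wt_pos (P := P) (2 * δ) ρ x
  have hq := wt_pos (P := P) (2 * δ) ρ (Site.shift x lam)
  rw [inv_eq_one_div, inv_eq_one_div, div_le_iff₀ hq] at h1'
  have : 1 ≤ 3 / 2 * (1 / wt P (2 * δ) ρ x) * wt P (2 * δ) ρ (Site.shift x lam) := h1'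
  rw [mul_comm, ← mul_assoc, mul_one_div, le_div_iff₀ hp] at this
  linarith

/-- backward versions: `ω(x − e) ≤ (3/2)ω(x)` and `|η⁻¹(ω(x − e) − ω(x))| ≤ 6δω(x)`. [cite: Balaban1984PropagatorsI, p.36] -/
theorem omega_backstep (hρ : LipX P k ρ) (hδ0 : 0 ≤ δ) (hδ8 : 8 * δ ≤ 1) (x : Site P 0) (lam : Fin P.d) :
    wt P (2 * δ) ρ (Site.unshift x lam) ≤ 3 / 2 * wt P (2 * δ) ρ x ∧
      |(((P.L : ℝ) ^ k)⁻¹)⁻¹ * (wt P (2 * δ) ρ (Site.unshift x lam) - wt P (2 * δ) ρ x)| ≤ 6 * δ * wt P (2 * δ) ρ x := by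
  obtain ⟨h1, h2, h3⟩ := omega_step hρ hδ0 hδ8 (Site.unshift x lam) lam
  rw [shift_unshift] at h1 h2 h3
  refine ⟨h2, ?_⟩
  rw [show wt P (2 * δ) ρ (Site.unshift x lam) - wt P (2 * δ) ρ x = -(wt P (2 * δ) ρ x - wt P (2 * δ) ρ (Site.unshift x lam))
    by ring, mul_neg, abs_neg]
  calc _ ≤ 4 * δ * wt P (2 * δ) ρ (Site.unshift x lam) := h3
    _ ≤ 4 * δ * (3 / 2 * wt P (2 * δ) ρ x) := mul_le_mul_of_nonneg_left h2 (by linarith)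
    _ = 6 * δ * wt P (2 * δ) ρ x := by ring

variable (P) in
/-- the ω-weighted sum of squares `Σ_x ω(x)f(x)²`. [cite: Balaban1984PropagatorsI, (1.114) p.36] -/
def Nw (ω f : Site P 0 → ℝ) : ℝ := ∑ x, ω x * f x ^ 2

/-- `0 ≤ Σωf²` for ω ≥ 0. [cite: Balaban1984PropagatorsI, (1.114) p.36] -/
theorem Nw_nonneg {ω : Site P 0 → ℝ} (hω : ∀ x, 0 ≤ ω x) (f : Site P 0 → ℝ) : 0 ≤ Nw P ω f :=
  sum_nonneg fun x _ => mul_nonneg (hω x) (sq_nonneg _)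

/-- pointwise AM–GM with a weight: `c·|a|·|b| ≤ (t/2)a² + (c²/(2t))b²` (t > 0). [cite: Balaban1984PropagatorsI, (1.114) p.36] -/
private theorem amgm {c t a b : ℝ} (ht : 0 < t) : c * (|a| * |b|) ≤ t / 2 * a ^ 2 + c ^ 2 / (2 * t) * b ^ 2 := by
  have h := sq_nonneg (t * |a| - c * |b|)
  have ht' : t ≠ 0 := ht.ne'
  rw [← sq_abs a, ← sq_abs b]
  have e : t / 2 * |a| ^ 2 + c ^ 2 / (2 * t) * |b| ^ 2 - c * (|a| * |b|) = (t * |a| - c * |b|) ^ 2 / (2 * t) := by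
    field_simp; ring
  have : 0 ≤ (t * |a| - c * |b|) ^ 2 / (2 * t) := by positivity
  linarith

/-- Step 1–3 of §2: for every ψ and direction λ,
`Σ_x ω(∂_λψ)² ≤ (3/2)·(∂ᵀ_λ∂_λψ)·(ωψ) + 18δ²·Σωψ² + (1/2)·Σω(∂_λψ)²`, i.e. after absorbing,
`Σ_x ω(∂_λψ)² ≤ 3·(∂ᵀ_λ∂_λψ)·(ωψ) + 36δ²·Σωψ²`. [cite: Balaban1984PropagatorsI, p.36, (1.114) p.36] -/
theorem weighted_first_step (hρ : LipX P k ρ) (hδ0 : 0 ≤ δ) (hδ8 : 8 * δ ≤ 1) (lam : Fin P.d) (ψ : Site P 0 → ℝ) :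
    Nw P (wt P (2 * δ) ρ) (deriv P 0 ((P.L : ℝ) ^ k)⁻¹ lam *ᵥ ψ)
      ≤ 3 * (((deriv P 0 ((P.L : ℝ) ^ k)⁻¹ lam)ᵀ *ᵥ (deriv P 0 ((P.L : ℝ) ^ k)⁻¹ lam *ᵥ ψ)) ⬝ᵥ
            pmul (wt P (2 * δ) ρ) ψ)
        + 36 * δ ^ 2 * Nw P (wt P (2 * δ) ρ) ψ := by
  set ω := wt P (2 * δ) ρ with hω
  set η := ((P.L : ℝ) ^ k)⁻¹ with hη
  set A := deriv P 0 η lam with hA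
  have hω0 : ∀ x, 0 ≤ ω x := fun x => (wt_pos _ _ x).le
  -- (∂ᵀ∂ψ)·(ωψ) = Σ ω(x⁺)(∂ψ)² + Σ (∂ω)ψ∂ψ
  have hid : (Aᵀ *ᵥ (A *ᵥ ψ)) ⬝ᵥ pmul ω ψ
      = ∑ x, ω (Site.shift x lam) * (A *ᵥ ψ) x ^ 2 + ∑ x, (A *ᵥ ω) x * ψ x * (A *ᵥ ψ) x := by
    rw [derivT_dot, dotProduct, ← sum_add_distrib]
    refine sum_congr rfl fun x _ => ?_
    rw [hA, deriv_pmul, deriv_mulVec η lam ω x]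
    ring
  -- the error term
  have herr : |∑ x, (A *ᵥ ω) x * ψ x * (A *ᵥ ψ) x| ≤ 12 * δ ^ 2 * Nw P ω ψ + 1 / 3 * Nw P ω (A *ᵥ ψ) := by
    calc |∑ x, (A *ᵥ ω) x * ψ x * (A *ᵥ ψ) x| ≤ ∑ x, |(A *ᵥ ω) x * ψ x * (A *ᵥ ψ) x| := abs_sum_le_sum_abs _ _
      _ ≤ ∑ x, (12 * δ ^ 2 * (ω x * ψ x ^ 2) + 1 / 3 * (ω x * (A *ᵥ ψ) x ^ 2)) := by
          refine sum_le_sum fun x _ => ?_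
          obtain ⟨-, -, h3⟩ := omega_step hρ hδ0 hδ8 x lam
          have hAω : |(A *ᵥ ω) x| ≤ 4 * δ * ω x := by
            rw [hA, deriv_mulVec]; rw [← hω] at h3; exact h3
          rw [abs_mul, abs_mul]
          have h1 : |(A *ᵥ ω) x| * |ψ x| * |(A *ᵥ ψ) x| ≤ 4 * δ * ω x * (|ψ x| * |(A *ᵥ ψ) x|) := by
            rw [mul_assoc]
            exact mul_le_mul_of_nonneg_right hAω (mul_nonneg (abs_nonneg _) (abs_nonneg _))
          have h2 : 4 * δ * (|ψ x| * |(A *ᵥ ψ) x|) ≤ 12 * δ ^ 2 * ψ x ^ 2 + 1 / 3 * (A *ᵥ ψ) x ^ 2 := by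
            nlinarith [sq_nonneg (6 * δ * |ψ x| - |(A *ᵥ ψ) x|), sq_abs (ψ x), sq_abs ((A *ᵥ ψ) x)]
          have h3' := mul_le_mul_of_nonneg_left h2 (hω0 x)
          nlinarith [hω0 x]
      _ = 12 * δ ^ 2 * Nw P ω ψ + 1 / 3 * Nw P ω (A *ᵥ ψ) := by
          rw [sum_add_distrib, Nw, Nw, mul_sum, mul_sum]
  -- ω(x) ≤ (3/2) ω(x⁺)
  have hmain : Nw P ω (A *ᵥ ψ) ≤ 3 / 2 * ∑ x, ω (Site.shift x lam) * (A *ᵥ ψ) x ^ 2 := by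
    rw [Nw, mul_sum]
    refine sum_le_sum fun x _ => ?_
    obtain ⟨-, h2, -⟩ := omega_step hρ hδ0 hδ8 x lam
    rw [← mul_assoc]
    exact mul_le_mul_of_nonneg_right h2 (sq_nonneg _)
  have hs : ∑ x, ω (Site.shift x lam) * (A *ᵥ ψ) x ^ 2
      = (Aᵀ *ᵥ (A *ᵥ ψ)) ⬝ᵥ pmul ω ψ - ∑ x, (A *ᵥ ω) x * ψ x * (A *ᵥ ψ) x := by rw [hid]; ring
  have habs := (abs_le.mp herr).1
  rw [hs] at hmain
  nlinarith [Nw_nonneg hω0 (A *ᵥ ψ)]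

/-- Step 5 of §2: `(∂_λ′Φ)·(ω∂_λ′φ) ≤ Φ·(ω∂ᵀ_λ′∂_λ′φ) + 6δ·Σω|Φ||(∂_λ′φ)(· − e)|`, with the shifted sum controlled:
`(∂_λ′Φ)·(ω∂_λ′φ) ≤ Σ_x ωΦ(∂ᵀ∂φ) + t/2·ΣωΦ² + (27δ²/t)·Σω(∂_λ′φ)²` (t > 0). [cite: Balaban1984PropagatorsI, p.36, (1.114) p.36] -/
theorem weighted_transfer_step (hρ : LipX P k ρ) (hδ0 : 0 ≤ δ) (hδ8 : 8 * δ ≤ 1) (lam' : Fin P.d)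
    (Φ φ : Site P 0 → ℝ) {t : ℝ} (ht : 0 < t) :
    (deriv P 0 ((P.L : ℝ) ^ k)⁻¹ lam' *ᵥ Φ) ⬝ᵥ pmul (wt P (2 * δ) ρ) (deriv P 0 ((P.L : ℝ) ^ k)⁻¹ lam' *ᵥ φ)
      ≤ ∑ x, wt P (2 * δ) ρ x * Φ x *
            (((deriv P 0 ((P.L : ℝ) ^ k)⁻¹ lam')ᵀ *ᵥ (deriv P 0 ((P.L : ℝ) ^ k)⁻¹ lam' *ᵥ φ)) x)
        + t / 2 * Nw P (wt P (2 * δ) ρ) Φ + (27 * δ ^ 2 / t) * Nw P (wt P (2 * δ) ρ) (deriv P 0 ((P.L : ℝ) ^ k)⁻¹ lam' *ᵥ φ) := by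
  set ω := wt P (2 * δ) ρ with hω
  set η := ((P.L : ℝ) ^ k)⁻¹ with hη
  set A := deriv P 0 η lam' with hA
  set h := A *ᵥ φ with hh
  have hω0 : ∀ x, 0 ≤ ω x := fun x => (wt_pos _ _ x).le
  -- move ∂ to the other side and apply the transpose product rule
  have hid : (A *ᵥ Φ) ⬝ᵥ pmul ω h
      = ∑ x, ω x * Φ x * (Aᵀ *ᵥ h) x + ∑ x, Φ x * (η⁻¹ * (ω (Site.unshift x lam') - ω x) * h (Site.unshift x lam')) := by
    rw [dotProduct_comm, Matrix.dotProduct_mulVec, ← Matrix.mulVec_transpose, dotProduct, ← sum_add_distrib]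
    refine sum_congr rfl fun x _ => ?_
    rw [hA, derivT_pmul]
    ring
  rw [hid]
  -- the error term
  have herr : ∑ x, Φ x * (η⁻¹ * (ω (Site.unshift x lam') - ω x) * h (Site.unshift x lam'))
      ≤ t / 2 * Nw P ω Φ + (27 * δ ^ 2 / t) * Nw P ω h := by
    have hsh : ∑ x, ω x * h (Site.unshift x lam') ^ 2 ≤ 3 / 2 * Nw P ω h := by
      have e : ∑ x, ω x * h (Site.unshift x lam') ^ 2 = ∑ x, ω (Site.shift x lam') * h x ^ 2 := by
        rw [← sum_unshift lam' (fun x => ω (Site.shift x lam') * h x ^ 2)]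
        simp only [shift_unshift]
      rw [e, Nw, mul_sum]
      refine sum_le_sum fun x _ => ?_
      obtain ⟨h1, -, -⟩ := omega_step hρ hδ0 hδ8 x lam'
      rw [← mul_assoc]
      exact mul_le_mul_of_nonneg_right h1 (sq_nonneg _)
    calc ∑ x, Φ x * (η⁻¹ * (ω (Site.unshift x lam') - ω x) * h (Site.unshift x lam'))
        ≤ ∑ x, (t / 2 * (ω x * Φ x ^ 2) + (18 * δ ^ 2 / t) * (ω x * h (Site.unshift x lam') ^ 2)) := by
          refine sum_le_sum fun x _ => ?_
          obtain ⟨-, hb⟩ := omega_backstep hρ hδ0 hδ8 x lam'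
          rw [← hη, ← hω] at hb
          have h1 : Φ x * (η⁻¹ * (ω (Site.unshift x lam') - ω x) * h (Site.unshift x lam'))
              ≤ |Φ x| * (6 * δ * ω x) * |h (Site.unshift x lam')| := by
            calc _ ≤ |Φ x * (η⁻¹ * (ω (Site.unshift x lam') - ω x) * h (Site.unshift x lam'))| := le_abs_self _
              _ = |Φ x| * |η⁻¹ * (ω (Site.unshift x lam') - ω x)| * |h (Site.unshift x lam')| := by
                  simp only [abs_mul, mul_assoc]
              _ ≤ |Φ x| * (6 * δ * ω x) * |h (Site.unshift x lam')| := by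
                  refine mul_le_mul_of_nonneg_right (mul_le_mul_of_nonneg_left hb (abs_nonneg _)) (abs_nonneg _)
          have h2 : (6 * δ) * (|Φ x| * |h (Site.unshift x lam')|)
              ≤ t / 2 * Φ x ^ 2 + (6 * δ) ^ 2 / (2 * t) * h (Site.unshift x lam') ^ 2 := amgm ht
          have h3 := mul_le_mul_of_nonneg_left h2 (hω0 x)
          have e : (6 * δ) ^ 2 / (2 * t) = 18 * δ ^ 2 / t := by field_simp; ring
          rw [e] at h3
          nlinarith [hω0 x]
      _ = t / 2 * Nw P ω Φ + (18 * δ ^ 2 / t) * ∑ x, ω x * h (Site.unshift x lam') ^ 2 := by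
          rw [sum_add_distrib, Nw, mul_sum, mul_sum]
      _ ≤ t / 2 * Nw P ω Φ + (18 * δ ^ 2 / t) * (3 / 2 * Nw P ω h) := by
          have : 0 ≤ 18 * δ ^ 2 / t := by positivity
          nlinarith
      _ = t / 2 * Nw P ω Φ + (27 * δ ^ 2 / t) * Nw P ω h := by ring
  linarith


/-- **THE WEIGHTED SECOND-ORDER INEQUALITY** (ω = e^{2δρ}, ρ `distX`-Lipschitz, 0 ≤ δ, 8δ ≤ 1): for every φ,
`Σ_{λ′}Σ_λ Σ_x ω(∂_λ∂_λ′φ)² ≤ 5·Σ_x ω(Δφ)² + 120·d·δ²·Σ_λ Σ_x ω(∂_λφ)²` — the torus identity Σ‖∂∂φ‖² = ‖Δφ‖² made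
robust under the conjugation weight (ω differentiated once only). [cite: Balaban1984PropagatorsI, p.36 («e^{−⟨q,x⟩}Δ_a e^{⟨q,x⟩} − Δ_a … small perturbation»), (1.114) p.36 (‖ζ∇∇GJ‖)] -/
theorem weighted_second_order (hρ : LipX P k ρ) (hδ0 : 0 ≤ δ) (hδ8 : 8 * δ ≤ 1) (φ : Site P 0 → ℝ) :
    ∑ lam', ∑ lam, Nw P (wt P (2 * δ) ρ)
        (deriv P 0 ((P.L : ℝ) ^ k)⁻¹ lam *ᵥ (deriv P 0 ((P.L : ℝ) ^ k)⁻¹ lam' *ᵥ φ))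
      ≤ 5 * Nw P (wt P (2 * δ) ρ) (lap P ((P.L : ℝ) ^ k)⁻¹ φ)
        + 120 * P.d * δ ^ 2 * ∑ lam, Nw P (wt P (2 * δ) ρ) (deriv P 0 ((P.L : ℝ) ^ k)⁻¹ lam *ᵥ φ) := by
  set ω := wt P (2 * δ) ρ with hω
  set η := ((P.L : ℝ) ^ k)⁻¹ with hη
  have hω0 : ∀ x, 0 ≤ ω x := fun x => (wt_pos _ _ x).le
  have hd1 : (1 : ℝ) ≤ P.d := by exact_mod_cast P.hd
  have hdpos : (0 : ℝ) < P.d := by linarith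
  have hN1 : 0 ≤ ∑ lam, Nw P ω (deriv P 0 η lam *ᵥ φ) := sum_nonneg fun _ _ => Nw_nonneg hω0 _
  have hΦ0 : 0 ≤ Nw P ω (lap P η φ) := Nw_nonneg hω0 _
  have hlapx : ∀ ψ : Site P 0 → ℝ, ∀ x,
      (∑ lam, (deriv P 0 η lam)ᵀ *ᵥ (deriv P 0 η lam *ᵥ ψ)) x = lap P η ψ x := fun ψ x => rfl
  -- Step A, summed over λ, for each λ′
  have hA : ∀ lam', ∑ lam, Nw P ω (deriv P 0 η lam *ᵥ (deriv P 0 η lam' *ᵥ φ))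
      ≤ 3 * ((deriv P 0 η lam' *ᵥ lap P η φ) ⬝ᵥ pmul ω (deriv P 0 η lam' *ᵥ φ))
        + P.d * (36 * δ ^ 2 * Nw P ω (deriv P 0 η lam' *ᵥ φ)) := by
    intro lam'
    have hs := sum_le_sum fun lam (_ : lam ∈ (univ : Finset (Fin P.d))) =>
      weighted_first_step hρ hδ0 hδ8 lam (deriv P 0 η lam' *ᵥ φ)
    rw [sum_add_distrib, ← mul_sum, ← sum_dotProduct, sum_const, card_univ, Fintype.card_fin, nsmul_eq_mul] at hs
    have hl : ∑ lam, (deriv P 0 η lam)ᵀ *ᵥ (deriv P 0 η lam *ᵥ (deriv P 0 η lam' *ᵥ φ))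
        = deriv P 0 η lam' *ᵥ lap P η φ := by
      rw [← lap_deriv_comm]; rfl
    rw [hl] at hs
    exact hs
  -- Step B, summed over λ′, with t = 1/d
  have hB : ∑ lam', (deriv P 0 η lam' *ᵥ lap P η φ) ⬝ᵥ pmul ω (deriv P 0 η lam' *ᵥ φ)
      ≤ 3 / 2 * Nw P ω (lap P η φ) + 27 * P.d * δ ^ 2 * ∑ lam', Nw P ω (deriv P 0 η lam' *ᵥ φ) := by
    have ht : (0 : ℝ) < 1 / P.d := by positivity
    have hterm : ∀ lam', (deriv P 0 η lam' *ᵥ lap P η φ) ⬝ᵥ pmul ω (deriv P 0 η lam' *ᵥ φ)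
        ≤ ∑ x, ω x * lap P η φ x * (((deriv P 0 η lam')ᵀ *ᵥ (deriv P 0 η lam' *ᵥ φ)) x)
          + (1 / P.d) / 2 * Nw P ω (lap P η φ)
          + (27 * δ ^ 2 / (1 / P.d)) * Nw P ω (deriv P 0 η lam' *ᵥ φ) :=
      fun lam' => weighted_transfer_step hρ hδ0 hδ8 lam' (lap P η φ) φ ht
    have hs := sum_le_sum fun lam' (_ : lam' ∈ (univ : Finset (Fin P.d))) => hterm lam'
    have hmain : ∑ lam', ∑ x, ω x * lap P η φ x * (((deriv P 0 η lam')ᵀ *ᵥ (deriv P 0 η lam' *ᵥ φ)) x)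
        = Nw P ω (lap P η φ) := by
      rw [sum_comm]
      unfold Nw
      refine sum_congr rfl fun x _ => ?_
      rw [← mul_sum, ← Finset.sum_apply, hlapx]
      ring
    have hconst : ∑ _lam' : Fin P.d, (1 / (P.d : ℝ)) / 2 * Nw P ω (lap P η φ) = 1 / 2 * Nw P ω (lap P η φ) := by
      rw [sum_const, card_univ, Fintype.card_fin, nsmul_eq_mul]
      field_simp
    have hlast : ∑ lam', (27 * δ ^ 2 / (1 / P.d)) * Nw P ω (deriv P 0 η lam' *ᵥ φ)
        = 27 * P.d * δ ^ 2 * ∑ lam', Nw P ω (deriv P 0 η lam' *ᵥ φ) := by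
      rw [← mul_sum]
      congr 1
      field_simp
    rw [sum_add_distrib, sum_add_distrib, hmain, hconst, hlast] at hs
    linarith
  -- assembly
  have hdN : 0 ≤ (P.d : ℝ) * δ ^ 2 * ∑ lam, Nw P ω (deriv P 0 η lam *ᵥ φ) := by positivity
  calc ∑ lam', ∑ lam, Nw P ω (deriv P 0 η lam *ᵥ (deriv P 0 η lam' *ᵥ φ))
      ≤ ∑ lam', (3 * ((deriv P 0 η lam' *ᵥ lap P η φ) ⬝ᵥ pmul ω (deriv P 0 η lam' *ᵥ φ))
          + P.d * (36 * δ ^ 2 * Nw P ω (deriv P 0 η lam' *ᵥ φ))) := sum_le_sum fun lam' _ => hA lam'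
    _ = 3 * ∑ lam', (deriv P 0 η lam' *ᵥ lap P η φ) ⬝ᵥ pmul ω (deriv P 0 η lam' *ᵥ φ)
          + 36 * P.d * δ ^ 2 * ∑ lam', Nw P ω (deriv P 0 η lam' *ᵥ φ) := by
        rw [sum_add_distrib, ← mul_sum, ← mul_sum, ← mul_sum]; ring
    _ ≤ 3 * (3 / 2 * Nw P ω (lap P η φ) + 27 * P.d * δ ^ 2 * ∑ lam', Nw P ω (deriv P 0 η lam' *ᵥ φ))
          + 36 * P.d * δ ^ 2 * ∑ lam', Nw P ω (deriv P 0 η lam' *ᵥ φ) := by linarith [hB]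
    _ ≤ 5 * Nw P ω (lap P η φ) + 120 * P.d * δ ^ 2 * ∑ lam, Nw P ω (deriv P 0 η lam *ᵥ φ) := by
        linarith

end Weighted

/-! ## §3 The entry ‖ζ∇∇G₀J‖ -/

section Kernel

variable {ρ : Site P 0 → ℝ} {δ : ℝ}

/-- `Σ_x e^{2δρ}f² = Σ_x (e^{δρ}f)²`. [cite: Balaban1984PropagatorsI, p.36] -/
theorem Nw_wt_two_mul (δ : ℝ) (ρ f : Site P 0 → ℝ) : Nw P (wt P (2 * δ) ρ) f = nsq P (pmul (wt P δ ρ) f) := by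
  unfold Nw nsq
  refine sum_congr rfl fun x _ => ?_
  rw [wt_two_mul, pmul_apply]; ring

/-- `Q*_μ` entrywise: `(Q*_μh)(x) = L^{dk}·Σ_y Q_μ(y,x)h(y)`. [cite: Balaban1984PropagatorsI, (1.132) p.39 (Q*)] -/
theorem QvT_mulVec_apply (k : ℕ) (μ : Fin P.d) (h : Site P k → ℝ) (x : Site P 0) :
    (QvT P k μ *ᵥ h) x = ((P.L : ℝ) ^ P.d) ^ lvl P k * ∑ y, Qv P k μ y x * h y := by
  rw [QvT, Matrix.smul_mulVec, Pi.smul_apply, smul_eq_mul]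
  simp only [Matrix.mulVec, dotProduct, Matrix.transpose_apply]

/-- **Schur bound for `Q*_μQ_μ`** (a nonnegative kernel with unit row and column sums): `Σ_x (Q*_μQ_μf)² ≤ Σ_x f²`.
[cite: Balaban1984PropagatorsI, (1.18) p.20, (1.132) p.39] -/
theorem nsq_QvTQv_le (hk : k ≤ P.m + P.K) (μ : Fin P.d) (f : Site P 0 → ℝ) :
    nsq P (QvT P k μ *ᵥ (Qv P k μ *ᵥ f)) ≤ nsq P f := by
  set c := ((P.L : ℝ) ^ P.d) ^ lvl P k with hc
  set e := (((P.L : ℝ) ^ k)⁻¹) ^ P.d with he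
  have hq := Qv_nonneg (P := P) k μ
  have hce : c * e = 1 := Lpow_mul_eta_pow hk
  have he0 : 0 ≤ e := pow_nonneg (eta_pos k).le _
  set h := Qv P k μ *ᵥ f with hh
  have hx : ∀ x, ((QvT P k μ *ᵥ h) x) ^ 2 ≤ c ^ 2 * (e * ∑ y, Qv P k μ y x * h y ^ 2) := by
    intro x
    rw [QvT_mulVec_apply, mul_pow]
    refine mul_le_mul_of_nonneg_left ?_ (sq_nonneg _)
    have hcs := sum_mul_sq_le_sq_mul_sq (univ : Finset (Site P k))
      (fun y => Real.sqrt (Qv P k μ y x)) (fun y => Real.sqrt (Qv P k μ y x) * h y)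
    have e1 : ∀ y, Real.sqrt (Qv P k μ y x) * (Real.sqrt (Qv P k μ y x) * h y) = Qv P k μ y x * h y := by
      intro y; rw [← mul_assoc, Real.mul_self_sqrt (hq y x)]
    have e2 : ∀ y, Real.sqrt (Qv P k μ y x) ^ 2 = Qv P k μ y x := fun y => Real.sq_sqrt (hq y x)
    have e3 : ∀ y, (Real.sqrt (Qv P k μ y x) * h y) ^ 2 = Qv P k μ y x * h y ^ 2 := by
      intro y; rw [mul_pow, e2]
    simp_rw [e1, e2, e3, Qv_colsum hk μ x] at hcs
    exact hcs
  calc nsq P (QvT P k μ *ᵥ h) = ∑ x, ((QvT P k μ *ᵥ h) x) ^ 2 := rfl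
    _ ≤ ∑ x, c ^ 2 * (e * ∑ y, Qv P k μ y x * h y ^ 2) := sum_le_sum fun x _ => hx x
    _ = c ^ 2 * e * ∑ y, (∑ x, Qv P k μ y x) * h y ^ 2 := by
        rw [← mul_sum, ← mul_sum, ← mul_assoc, sum_comm]; simp_rw [sum_mul]
    _ = c ^ 2 * e * ∑ y, h y ^ 2 := by simp_rw [Qv_rowsum hk μ, one_mul]
    _ ≤ c ^ 2 * e * (e * ∑ x, f x ^ 2) := by
        refine mul_le_mul_of_nonneg_left ?_ (by positivity)
        rw [hh]; exact sum_sq_Qv_mulVec_le hk μ f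
    _ = nsq P f := by
        rw [show c ^ 2 * e * (e * ∑ x, f x ^ 2) = (c * e) ^ 2 * ∑ x, f x ^ 2 by ring, hce, one_pow, one_mul]; rfl

/-- the conjugation weight across the support of one block average: `e^{δρ(x)} ≤ 2e^{δρ(x′)}` for Q_μ(y,x) ≠ 0 ≠ Q_μ(y,x′)
(|ρ(x) − ρ(x′)| ≤ 4, 8δ ≤ 1). [cite: Balaban1984PropagatorsI, p.36, (1.18) p.20] -/
theorem wt_le_two_mul_of_Qv (hρ : LipX P k ρ) (hk : k ≤ P.m + P.K) (hδ0 : 0 ≤ δ) (hδ8 : 8 * δ ≤ 1) {μ : Fin P.d}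
    {y : Site P k} {x x' : Site P 0} (hx : Qv P k μ y x ≠ 0) (hx' : Qv P k μ y x' ≠ 0) :
    wt P δ ρ x ≤ 2 * wt P δ ρ x' := by
  have h4 := hρ.abs_sub_le_four_of_Qv hk hx hx'
  have hprod := mul_le_mul_of_nonneg_left h4 hδ0
  have hσ : |δ * (ρ x - ρ x')| ≤ 1 := by
    rw [abs_mul, abs_of_nonneg hδ0]; linarith
  have he := (abs_le.mp (Real.abs_exp_sub_one_le hσ)).2
  rw [abs_mul, abs_of_nonneg hδ0] at he
  have hexp : Real.exp (δ * (ρ x - ρ x')) ≤ 2 := by linarith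
  have hdiv := wt_div δ ρ x' x
  rw [div_eq_iff (wt_ne_zero δ ρ x')] at hdiv
  rw [hdiv]
  exact mul_le_mul_of_nonneg_right hexp (wt_pos δ ρ x').le

/-- pointwise: `|e^{δρ(x)}(Q*_μQ_μv)(x)| ≤ 2·(Q*_μQ_μ|e^{δρ}v|)(x)`. [cite: Balaban1984PropagatorsI, p.36, (1.132) p.39] -/
theorem abs_wt_QvTQv_le (hρ : LipX P k ρ) (hk : k ≤ P.m + P.K) (hδ0 : 0 ≤ δ) (hδ8 : 8 * δ ≤ 1) (μ : Fin P.d)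
    (v : Site P 0 → ℝ) (x : Site P 0) :
    |wt P δ ρ x * (QvT P k μ *ᵥ (Qv P k μ *ᵥ v)) x|
      ≤ 2 * (QvT P k μ *ᵥ (Qv P k μ *ᵥ fun z => |wt P δ ρ z * v z|)) x := by
  have hq := Qv_nonneg (P := P) k μ
  have hc : 0 ≤ ((P.L : ℝ) ^ P.d) ^ lvl P k := by positivity
  have hy : ∀ y, |wt P δ ρ x * (Qv P k μ y x * (Qv P k μ *ᵥ v) y)|
      ≤ 2 * (Qv P k μ y x * (Qv P k μ *ᵥ fun z => |wt P δ ρ z * v z|) y) := by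
    intro y
    by_cases hyx : Qv P k μ y x = 0
    · rw [hyx]; simp
    simp only [Matrix.mulVec, dotProduct, mul_sum]
    calc |∑ x', wt P δ ρ x * (Qv P k μ y x * (Qv P k μ y x' * v x'))|
        ≤ ∑ x', |wt P δ ρ x * (Qv P k μ y x * (Qv P k μ y x' * v x'))| := abs_sum_le_sum_abs _ _
      _ ≤ ∑ x', 2 * (Qv P k μ y x * (Qv P k μ y x' * |wt P δ ρ x' * v x'|)) := by
          refine sum_le_sum fun x' _ => ?_
          by_cases hyx' : Qv P k μ y x' = 0
          · rw [hyx']; simp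
          have hw := wt_le_two_mul_of_Qv hρ hk hδ0 hδ8 hyx hyx'
          have h1 : |wt P δ ρ x * (Qv P k μ y x * (Qv P k μ y x' * v x'))|
              = Qv P k μ y x * Qv P k μ y x' * (wt P δ ρ x * |v x'|) := by
            rw [abs_mul, abs_mul, abs_mul, abs_of_nonneg (wt_pos δ ρ x).le, abs_of_nonneg (hq y x),
              abs_of_nonneg (hq y x')]; ring
          have h2 : 2 * (Qv P k μ y x * (Qv P k μ y x' * |wt P δ ρ x' * v x'|))
              = Qv P k μ y x * Qv P k μ y x' * (2 * wt P δ ρ x' * |v x'|) := by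
            rw [abs_mul, abs_of_nonneg (wt_pos δ ρ x').le]; ring
          rw [h1, h2]
          refine mul_le_mul_of_nonneg_left ?_ (mul_nonneg (hq y x) (hq y x'))
          exact mul_le_mul_of_nonneg_right hw (abs_nonneg _)
  rw [QvT_mulVec_apply, QvT_mulVec_apply]
  calc |wt P δ ρ x * (((P.L : ℝ) ^ P.d) ^ lvl P k * ∑ y, Qv P k μ y x * (Qv P k μ *ᵥ v) y)|
      = ((P.L : ℝ) ^ P.d) ^ lvl P k * |∑ y, wt P δ ρ x * (Qv P k μ y x * (Qv P k μ *ᵥ v) y)| := by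
        rw [mul_left_comm, abs_mul, abs_of_nonneg hc, mul_sum]
    _ ≤ ((P.L : ℝ) ^ P.d) ^ lvl P k * ∑ y, |wt P δ ρ x * (Qv P k μ y x * (Qv P k μ *ᵥ v) y)| :=
        mul_le_mul_of_nonneg_left (abs_sum_le_sum_abs _ _) hc
    _ ≤ ((P.L : ℝ) ^ P.d) ^ lvl P k * ∑ y, 2 * (Qv P k μ y x * (Qv P k μ *ᵥ fun z => |wt P δ ρ z * v z|) y) :=
        mul_le_mul_of_nonneg_left (sum_le_sum fun y _ => hy y) hc
    _ = 2 * (((P.L : ℝ) ^ P.d) ^ lvl P k * ∑ y, Qv P k μ y x * (Qv P k μ *ᵥ fun z => |wt P δ ρ z * v z|) y) := by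
        rw [← mul_sum]; ring

/-- **weighted averaging term**: `Σ_x (e^{δρ}Q*_μQ_μv)² ≤ 4·Σ_x (e^{δρ}v)²`. [cite: Balaban1984PropagatorsI, p.36, (1.132) p.39] -/
theorem nsq_wt_QvTQv_le (hρ : LipX P k ρ) (hk : k ≤ P.m + P.K) (hδ0 : 0 ≤ δ) (hδ8 : 8 * δ ≤ 1) (μ : Fin P.d)
    (v : Site P 0 → ℝ) :
    nsq P (pmul (wt P δ ρ) (QvT P k μ *ᵥ (Qv P k μ *ᵥ v))) ≤ 4 * nsq P (pmul (wt P δ ρ) v) := by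
  have hS := nsq_QvTQv_le hk μ (fun z => |wt P δ ρ z * v z|)
  have habs : nsq P (fun z => |wt P δ ρ z * v z|) = nsq P (pmul (wt P δ ρ) v) := by
    unfold nsq; simp_rw [sq_abs]; rfl
  calc nsq P (pmul (wt P δ ρ) (QvT P k μ *ᵥ (Qv P k μ *ᵥ v)))
      = ∑ x, (wt P δ ρ x * (QvT P k μ *ᵥ (Qv P k μ *ᵥ v)) x) ^ 2 := rfl
    _ ≤ ∑ x, (2 * (QvT P k μ *ᵥ (Qv P k μ *ᵥ fun z => |wt P δ ρ z * v z|)) x) ^ 2 := by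
        refine sum_le_sum fun x _ => ?_
        have h := abs_wt_QvTQv_le hρ hk hδ0 hδ8 μ v x
        rw [← sq_abs]
        exact pow_le_pow_left₀ (abs_nonneg _) h 2
    _ = 4 * nsq P (QvT P k μ *ᵥ (Qv P k μ *ᵥ fun z => |wt P δ ρ z * v z|)) := by
        unfold nsq; rw [mul_sum]; refine sum_congr rfl fun x _ => ?_; ring
    _ ≤ 4 * nsq P (pmul (wt P δ ρ) v) := by rw [← habs]; linarith

/-- **weighted first derivatives of v from those of u = e^{δρ}v**: `Σ_x (e^{δρ}∂_λv)² ≤ (9/2)Σ_x(∂_λu)² + 8δ²Σ_x u²`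
(4δ ≤ 1). [cite: Balaban1984PropagatorsI, p.36] -/
theorem nsq_wt_deriv_le (hρ : LipX P k ρ) (hδ0 : 0 ≤ δ) (hδ4 : 4 * δ ≤ 1) (lam : Fin P.d) (v : Site P 0 → ℝ) :
    nsq P (pmul (wt P δ ρ) (deriv P 0 ((P.L : ℝ) ^ k)⁻¹ lam *ᵥ v))
      ≤ 9 / 2 * nsq P (deriv P 0 ((P.L : ℝ) ^ k)⁻¹ lam *ᵥ pmul (wt P δ ρ) v) + 8 * δ ^ 2 * nsq P (pmul (wt P δ ρ) v) := by
  set w := wt P δ ρ with hw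
  set u := pmul w v with hu
  have hv : v = pmul (wt P δ (fun z => -ρ z)) u := by
    funext x
    rw [pmul_apply, hu, pmul_apply, ← wt_inv, ← mul_assoc, inv_mul_cancel₀ (wt_ne_zero δ ρ x), one_mul]
  have hpt : ∀ x, (w x * (deriv P 0 ((P.L : ℝ) ^ k)⁻¹ lam *ᵥ v) x) ^ 2
      ≤ 9 / 2 * ((deriv P 0 ((P.L : ℝ) ^ k)⁻¹ lam *ᵥ u) x) ^ 2 + 8 * δ ^ 2 * (u x) ^ 2 := by
    intro x
    have h1 := abs_deriv_pmul_le hρ.neg hδ0 hδ4 lam u x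
    rw [← hv] at h1
    have hww : w x * wt P δ (fun z => -ρ z) x = 1 := by
      rw [← wt_inv, mul_inv_cancel₀ (wt_ne_zero δ ρ x)]
    have h2 : w x * |(deriv P 0 ((P.L : ℝ) ^ k)⁻¹ lam *ᵥ v) x|
        ≤ 3 / 2 * |(deriv P 0 ((P.L : ℝ) ^ k)⁻¹ lam *ᵥ u) x| + 2 * δ * |u x| := by
      have := mul_le_mul_of_nonneg_left h1 (wt_pos δ ρ x).le
      rw [← mul_assoc, ← hw, hww, one_mul] at this
      exact this
    have h0 : 0 ≤ w x * |(deriv P 0 ((P.L : ℝ) ^ k)⁻¹ lam *ᵥ v) x| := mul_nonneg (wt_pos δ ρ x).le (abs_nonneg _)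
    have h3 := pow_le_pow_left₀ h0 h2 2
    rw [mul_pow, sq_abs] at h3
    nlinarith [sq_nonneg (3 / 2 * |(deriv P 0 ((P.L : ℝ) ^ k)⁻¹ lam *ᵥ u) x| - 2 * δ * |u x|),
      sq_abs ((deriv P 0 ((P.L : ℝ) ^ k)⁻¹ lam *ᵥ u) x), sq_abs (u x)]
  unfold nsq
  rw [mul_sum, mul_sum, ← sum_add_distrib]
  exact sum_le_sum fun x _ => by rw [pmul_apply]; exact hpt x

end Kernel

section Entry

variable {a msq γ₀ δ : ℝ} {μ : Fin P.d} {ρ : Site P 0 → ℝ}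

/-- `Δv = g − (Lᵏε)²m²v − aQ*_μQ_μv` for v = G₀g (G₀⁻¹ = −Δ^η + (Lᵏε)²m² + aQ*_μQ_μ). [cite: Balaban1984PropagatorsI, (1.132) p.39] -/
theorem lap_G0_apply (hk : k ≤ P.m + P.K) (ha : 0 < a) (hm : 0 ≤ msq) (μ : Fin P.d) (g : Site P 0 → ℝ) (x : Site P 0) :
    lap P ((P.L : ℝ) ^ k)⁻¹ (G0 P a msq k μ *ᵥ g) x
      = g x - P.spacing k ^ 2 * msq * (G0 P a msq k μ *ᵥ g) x
          - a * (QvT P k μ *ᵥ (Qv P k μ *ᵥ (G0 P a msq k μ *ᵥ g))) x := by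
  set v := G0 P a msq k μ *ᵥ g with hv
  have hMv : M0 P a msq k μ *ᵥ v = g := by
    rw [hv, Matrix.mulVec_mulVec, M0_mul_G0 ha hm hk, Matrix.one_mulVec]
  have hM : M0 P a msq k μ *ᵥ v
      = (P.spacing k ^ 2 * msq) • v + lap P ((P.L : ℝ) ^ k)⁻¹ v + a • (QvT P k μ *ᵥ (Qv P k μ *ᵥ v)) := by
    rw [M0, eps_div_spacing, Matrix.add_mulVec, Matrix.smul_mulVec, ← Matrix.mulVec_mulVec, hOp_mulVec, lap]
  have hx := congrFun (hMv.symm.trans hM) x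
  simp only [Pi.add_apply, Pi.smul_apply, smul_eq_mul] at hx
  linarith

/-- the constant of the second-order entry (squared form): `75 + (60a² + 10d²)(2/γ₀)²`. [cite: Balaban1984PropagatorsI, (1.114) p.36 («there exists a constant O(1)»)] -/
def K4sq (P : Params) (a γ₀ : ℝ) : ℝ := 75 + (60 * a ^ 2 + 10 * (P.d : ℝ) ^ 2) * (2 / γ₀) ^ 2

/-- the constant of the second-order entry: `K₄ = 9 + (8a + 4d)(2/γ₀)` (`K4sq ≤ K4²`). [cite: Balaban1984PropagatorsI, (1.114) p.36 («there exists a constant O(1)»)] -/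
def K4 (P : Params) (a γ₀ : ℝ) : ℝ := 9 + (8 * a + 4 * (P.d : ℝ)) * (2 / γ₀)

/-- `0 ≤ K₄`. [cite: Balaban1984PropagatorsI, (1.114) p.36] -/
theorem K4_nonneg (ha : 0 ≤ a) (hγ : 0 < γ₀) : 0 ≤ K4 P a γ₀ := by
  unfold K4; positivity

/-- `K4sq ≤ K₄²`. [cite: Balaban1984PropagatorsI, (1.114) p.36] -/
theorem K4sq_le_sq (ha : 0 ≤ a) (hγ : 0 < γ₀) : K4sq P a γ₀ ≤ K4 P a γ₀ ^ 2 := by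
  unfold K4sq K4
  have ht : 0 ≤ 2 / γ₀ := by positivity
  have hd : (0 : ℝ) ≤ P.d := Nat.cast_nonneg _
  nlinarith [mul_nonneg ha ht, mul_nonneg hd ht, mul_nonneg (mul_nonneg ha hd) (mul_nonneg ht ht),
    mul_nonneg ht ht, mul_nonneg (mul_nonneg ha ha) (mul_nonneg ht ht), mul_nonneg (mul_nonneg hd hd) (mul_nonneg ht ht)]

/-- **THE WEIGHTED SECOND-ORDER SOLVE**: for v = G₀g, ρ Lipschitz, 8δ ≤ 1, (1.90) and (2d + 16a)δ² ≤ γ₀/2, every pair (λ, λ′):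
`Σ_x (e^{δρ}∂_λ∂_λ′G₀g)² ≤ K4sq·Σ_x (e^{δρ}g)²`. [cite: Balaban1984PropagatorsI, p.36, (1.114) p.36 (‖ζ∇∇GJ‖), p.39 (for G₀)] -/
theorem nsq_wt_ddG0_le (hρ : LipX P k ρ) (hk : k ≤ P.m + P.K) (ha : 0 < a) (hm : 0 ≤ msq) (μ : Fin P.d)
    (hγ : 0 < γ₀)
    (hco : ∀ f : Site P 0 → ℝ, γ₀ * (f ⬝ᵥ ((lapEta P k + 1) *ᵥ f)) ≤ f ⬝ᵥ (M0 P a msq k μ *ᵥ f))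
    (hδ0 : 0 ≤ δ) (hδ8 : 8 * δ ≤ 1) (hδγ : (2 * P.d + 16 * a) * δ ^ 2 ≤ γ₀ / 2)
    (g : Site P 0 → ℝ) (lam lam' : Fin P.d) :
    nsq P (pmul (wt P δ ρ) (deriv P 0 ((P.L : ℝ) ^ k)⁻¹ lam *ᵥ (deriv P 0 ((P.L : ℝ) ^ k)⁻¹ lam' *ᵥ
        (G0 P a msq k μ *ᵥ g))))
      ≤ K4sq P a γ₀ * nsq P (pmul (wt P δ ρ) g) := by
  have hδ4 : 4 * δ ≤ 1 := by linarith
  set w := wt P δ ρ with hw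
  set v := G0 P a msq k μ *ᵥ g with hv
  set u := pmul w v with hu
  set Wg := nsq P (pmul w g) with hWg
  set Kv := QvT P k μ *ᵥ (Qv P k μ *ᵥ v) with hKv
  set s2m := P.spacing k ^ 2 * msq with hs2m
  have hWg0 : 0 ≤ Wg := nsq_nonneg _
  have hZ0 : 0 ≤ (2 / γ₀) ^ 2 * Wg := by positivity
  have hd1 : (1 : ℝ) ≤ P.d := by exact_mod_cast P.hd
  have hd0 : (0 : ℝ) ≤ P.d := by linarith
  -- the weighted solve and the mass bound of `B5CombesThomasTorus`
  have hsolve : dirE P k u + nsq P u ≤ (2 / γ₀) ^ 2 * Wg := by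
    have := solve_bound hρ hk ha hm μ hγ hco hδ0 hδ4 hδγ g
    rw [← hw, ← hv, ← hu, ← hWg] at this; exact this
  have hnu : nsq P u ≤ (2 / γ₀) ^ 2 * Wg := by linarith [dirE_nonneg (P := P) k u]
  have hdir : dirE P k u ≤ (2 / γ₀) ^ 2 * Wg := by linarith [nsq_nonneg (P := P) u]
  have hmass : s2m ^ 2 * nsq P u ≤ 4 * Wg := by
    have hmb := mass_bound hρ hk ha hm μ hγ hco hδ0 hδ4 hδγ g
    rw [← hw, ← hv, ← hu, ← hWg, ← hs2m] at hmb
    have h0 : 0 ≤ s2m * Real.sqrt (nsq P u) := mul_nonneg (mul_nonneg (sq_nonneg _) hm) (Real.sqrt_nonneg _)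
    have h2 := mul_self_le_mul_self h0 hmb
    have e1 : s2m * Real.sqrt (nsq P u) * (s2m * Real.sqrt (nsq P u)) = s2m ^ 2 * nsq P u := by
      rw [mul_mul_mul_comm, Real.mul_self_sqrt (nsq_nonneg _)]; ring
    have e2 : 2 * Real.sqrt Wg * (2 * Real.sqrt Wg) = 4 * Wg := by
      rw [mul_mul_mul_comm, Real.mul_self_sqrt hWg0]; ring
    rw [e1, e2] at h2; exact h2
  -- the averaging term
  have hK : nsq P (pmul w Kv) ≤ 4 * nsq P u := nsq_wt_QvTQv_le hρ hk hδ0 hδ8 μ v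
  -- N0: the weighted norm of Δv
  have hN0 : nsq P (pmul w (lap P ((P.L : ℝ) ^ k)⁻¹ v)) ≤ 3 * (Wg + s2m ^ 2 * nsq P u + a ^ 2 * nsq P (pmul w Kv)) := by
    have hpt : ∀ x, (w x * lap P ((P.L : ℝ) ^ k)⁻¹ v x) ^ 2
        ≤ 3 * ((w x * g x) ^ 2 + s2m ^ 2 * (w x * v x) ^ 2 + a ^ 2 * (w x * Kv x) ^ 2) := by
      intro x
      rw [hv, lap_G0_apply hk ha hm μ g x, ← hv, ← hKv, ← hs2m]
      nlinarith [sq_nonneg (w x * g x + s2m * (w x * v x)), sq_nonneg (w x * g x + a * (w x * Kv x)),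
        sq_nonneg (s2m * (w x * v x) - a * (w x * Kv x))]
    have hsum := sum_le_sum fun x (_ : x ∈ (univ : Finset (Site P 0))) => hpt x
    have e : ∑ x, 3 * ((w x * g x) ^ 2 + s2m ^ 2 * (w x * v x) ^ 2 + a ^ 2 * (w x * Kv x) ^ 2)
        = 3 * (Wg + s2m ^ 2 * nsq P u + a ^ 2 * nsq P (pmul w Kv)) := by
      rw [hWg, hu]; unfold nsq
      rw [← mul_sum, sum_add_distrib, sum_add_distrib, ← mul_sum, ← mul_sum]
      simp only [pmul_apply]
    rw [e] at hsum
    unfold nsq at hsum ⊢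
    simp only [pmul_apply] at hsum ⊢
    exact hsum
  -- N1: the weighted first derivatives of v
  have hN1 : ∑ l, nsq P (pmul w (deriv P 0 ((P.L : ℝ) ^ k)⁻¹ l *ᵥ v))
      ≤ 9 / 2 * dirE P k u + 8 * P.d * δ ^ 2 * nsq P u := by
    have hs := sum_le_sum fun l (_ : l ∈ (univ : Finset (Fin P.d))) => nsq_wt_deriv_le hρ hδ0 hδ4 l v
    rw [sum_add_distrib, ← mul_sum, sum_const, card_univ, Fintype.card_fin, nsmul_eq_mul] at hs
    rw [← hw, ← hu] at hs
    have hdirE : ∑ l, nsq P (deriv P 0 ((P.L : ℝ) ^ k)⁻¹ l *ᵥ u) = dirE P k u := rfl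
    rw [hdirE] at hs
    linarith
  -- the weighted second-order inequality, one term of the double sum
  have hS := weighted_second_order hρ hδ0 hδ8 v
  simp_rw [Nw_wt_two_mul] at hS
  rw [← hw] at hS
  have hterm : nsq P (pmul w (deriv P 0 ((P.L : ℝ) ^ k)⁻¹ lam *ᵥ (deriv P 0 ((P.L : ℝ) ^ k)⁻¹ lam' *ᵥ v)))
      ≤ ∑ l', ∑ l, nsq P (pmul w (deriv P 0 ((P.L : ℝ) ^ k)⁻¹ l *ᵥ (deriv P 0 ((P.L : ℝ) ^ k)⁻¹ l' *ᵥ v))) := by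
    have h1 : nsq P (pmul w (deriv P 0 ((P.L : ℝ) ^ k)⁻¹ lam *ᵥ (deriv P 0 ((P.L : ℝ) ^ k)⁻¹ lam' *ᵥ v)))
        ≤ ∑ l, nsq P (pmul w (deriv P 0 ((P.L : ℝ) ^ k)⁻¹ l *ᵥ (deriv P 0 ((P.L : ℝ) ^ k)⁻¹ lam' *ᵥ v))) :=
      single_le_sum (f := fun l => nsq P (pmul w (deriv P 0 ((P.L : ℝ) ^ k)⁻¹ l *ᵥ
          (deriv P 0 ((P.L : ℝ) ^ k)⁻¹ lam' *ᵥ v)))) (fun l _ => nsq_nonneg _) (mem_univ lam)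
    refine h1.trans ?_
    exact single_le_sum (f := fun l' => ∑ l, nsq P (pmul w (deriv P 0 ((P.L : ℝ) ^ k)⁻¹ l *ᵥ
        (deriv P 0 ((P.L : ℝ) ^ k)⁻¹ l' *ᵥ v)))) (fun l' _ => sum_nonneg fun l _ => nsq_nonneg _) (mem_univ lam')
  -- arithmetic
  have hδsq : δ ^ 2 ≤ 1 / 64 := by nlinarith
  have ha2K : a ^ 2 * nsq P (pmul w Kv) ≤ a ^ 2 * (4 * ((2 / γ₀) ^ 2 * Wg)) :=
    mul_le_mul_of_nonneg_left (hK.trans (by linarith)) (sq_nonneg a)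
  have hN0' : nsq P (pmul w (lap P ((P.L : ℝ) ^ k)⁻¹ v)) ≤ 15 * Wg + 12 * a ^ 2 * ((2 / γ₀) ^ 2 * Wg) := by
    linarith
  have h5 : (P.d : ℝ) * δ ^ 2 * nsq P u ≤ P.d * (1 / 64) * ((2 / γ₀) ^ 2 * Wg) := by
    have h := mul_le_mul hδsq hnu (nsq_nonneg _) (by norm_num)
    have := mul_le_mul_of_nonneg_left h hd0
    linarith
  have hN1_0 : 0 ≤ ∑ l, nsq P (pmul w (deriv P 0 ((P.L : ℝ) ^ k)⁻¹ l *ᵥ v)) := sum_nonneg fun _ _ => nsq_nonneg _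
  have hN1' : ∑ l, nsq P (pmul w (deriv P 0 ((P.L : ℝ) ^ k)⁻¹ l *ᵥ v))
      ≤ 9 / 2 * ((2 / γ₀) ^ 2 * Wg) + P.d / 8 * ((2 / γ₀) ^ 2 * Wg) := by linarith
  have h6 : (P.d : ℝ) * δ ^ 2 * ∑ l, nsq P (pmul w (deriv P 0 ((P.L : ℝ) ^ k)⁻¹ l *ᵥ v))
      ≤ P.d * (1 / 64) * (9 / 2 * ((2 / γ₀) ^ 2 * Wg) + P.d / 8 * ((2 / γ₀) ^ 2 * Wg)) := by
    have h := mul_le_mul hδsq hN1' hN1_0 (by norm_num)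
    have := mul_le_mul_of_nonneg_left h hd0
    linarith
  have hd2 : (P.d : ℝ) * ((2 / γ₀) ^ 2 * Wg) ≤ (P.d : ℝ) ^ 2 * ((2 / γ₀) ^ 2 * Wg) := by
    have : (P.d : ℝ) ≤ (P.d : ℝ) ^ 2 := by nlinarith
    exact mul_le_mul_of_nonneg_right this hZ0
  have hd2B : 0 ≤ (P.d : ℝ) ^ 2 * ((2 / γ₀) ^ 2 * Wg) := by positivity
  have hfin : 5 * nsq P (pmul w (lap P ((P.L : ℝ) ^ k)⁻¹ v))
      + 120 * P.d * δ ^ 2 * ∑ l, nsq P (pmul w (deriv P 0 ((P.L : ℝ) ^ k)⁻¹ l *ᵥ v))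
      ≤ K4sq P a γ₀ * Wg := by
    unfold K4sq
    linarith
  linarith [hterm, hS, hfin]

/-- **‖U·∂_λ∂_λ′G₀g‖**: `Σ_x (U·∂_λ∂_λ′G₀g)² ≤ (b·K₄·e^{δ(r+1)}·e^{−δ|y−y′|})²·Σ_x g²` (U within `distX ≤ r` of y, |U| ≤ b,
supp g ⊂ Δ̃(y′), 8δ ≤ 1). [cite: Balaban1984PropagatorsI, (1.114) p.36 (‖ζ∇∇GJ‖), p.39 (for G₀)] -/
theorem cut_ddG0_sq_le (hk : k ≤ P.m + P.K) (ha : 0 < a) (hm : 0 ≤ msq) (hγ : 0 < γ₀)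
    (hco : ∀ f : Site P 0 → ℝ, γ₀ * (f ⬝ᵥ ((lapEta P k + 1) *ᵥ f)) ≤ f ⬝ᵥ (M0 P a msq k μ *ᵥ f))
    (hδ0 : 0 ≤ δ) (hδ8 : 8 * δ ≤ 1) (hδγ : (2 * P.d + 16 * a) * δ ^ 2 ≤ γ₀ / 2)
    (y y' : Site P k) {r b : ℝ} (hb : 0 ≤ b) (U g : Site P 0 → ℝ)
    (hU : ∀ x, U x ≠ 0 → distX P k x (fine P k y) ≤ r) (hUb : ∀ x, |U x| ≤ b)
    (hg : ∀ x, g x ≠ 0 → inCube P k x y') (lam lam' : Fin P.d) :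
    nsq P (fun x => U x * (deriv P 0 ((P.L : ℝ) ^ k)⁻¹ lam *ᵥ (deriv P 0 ((P.L : ℝ) ^ k)⁻¹ lam' *ᵥ
        (G0 P a msq k μ *ᵥ g))) x)
      ≤ (b * K4 P a γ₀ * Real.exp (δ * (r + 1)) * Real.exp (-(δ * T P k y y'))) ^ 2 * nsq P g := by
  set ρ := rhoY P k y' with hρ
  set w := wt P δ ρ with hw
  set F := deriv P 0 ((P.L : ℝ) ^ k)⁻¹ lam *ᵥ (deriv P 0 ((P.L : ℝ) ^ k)⁻¹ lam' *ᵥ (G0 P a msq k μ *ᵥ g)) with hF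
  set u2 := pmul w F with hu2
  have hFu : ∀ x, F x = (w x)⁻¹ * u2 x := by
    intro x; rw [hu2, pmul_apply, ← mul_assoc, inv_mul_cancel₀ (wt_ne_zero δ ρ x), one_mul]
  have h1 := loc_value hk hδ0 y y' hb U u2 hU hUb
  have h1' : nsq P (fun x => U x * F x) ≤ (b * Real.exp (δ * r) * Real.exp (-(δ * T P k y y'))) ^ 2 * nsq P u2 := by
    have e : (fun x => U x * F x) = fun x => U x * ((wt P δ (rhoY P k y') x)⁻¹ * u2 x) := by
      funext x; rw [hFu]
    rw [e]; exact h1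
  have h2 : nsq P u2 ≤ K4sq P a γ₀ * nsq P (pmul w g) := by
    rw [hu2, hF, hw]
    exact nsq_wt_ddG0_le (lipX_rhoY k y') hk ha hm μ hγ hco hδ0 hδ8 hδγ g lam lam'
  have h3 := nsq_wt_source_le hδ0 y' g hg
  rw [← hρ, ← hw] at h3
  have h4 := K4sq_le_sq (P := P) ha.le hγ
  have hK0 : 0 ≤ K4sq P a γ₀ := by unfold K4sq; positivity
  have hE : Real.exp (δ * (r + 1)) = Real.exp (δ * r) * Real.exp δ := by rw [← Real.exp_add]; ring_nf
  have hg0 := nsq_nonneg (P := P) g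
  calc nsq P (fun x => U x * F x)
      ≤ (b * Real.exp (δ * r) * Real.exp (-(δ * T P k y y'))) ^ 2 * nsq P u2 := h1'
    _ ≤ (b * Real.exp (δ * r) * Real.exp (-(δ * T P k y y'))) ^ 2 * (K4 P a γ₀ ^ 2 * (Real.exp δ ^ 2 * nsq P g)) := by
        refine mul_le_mul_of_nonneg_left ?_ (sq_nonneg _)
        calc nsq P u2 ≤ K4sq P a γ₀ * nsq P (pmul w g) := h2
          _ ≤ K4sq P a γ₀ * (Real.exp δ ^ 2 * nsq P g) := mul_le_mul_of_nonneg_left h3 hK0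
          _ ≤ K4 P a γ₀ ^ 2 * (Real.exp δ ^ 2 * nsq P g) := mul_le_mul_of_nonneg_right h4 (by positivity)
    _ = (b * K4 P a γ₀ * Real.exp (δ * (r + 1)) * Real.exp (-(δ * T P k y y'))) ^ 2 * nsq P g := by rw [hE]; ring

/-- `e^{δ(1+1)} = e^{2δ}` bookkeeping. [cite: Balaban1984PropagatorsI, (1.114) p.36] -/
private theorem exp_one_add_one' (δ : ℝ) : Real.exp (δ * (1 + 1)) = Real.exp (2 * δ) := by ring_nf

/-- **(1.114), n = 4, for G₀ on the torus**: `‖ζ∇∇G₀J‖ ≤ d·K₄·e^{2δ}·e^{−δ|y−y′|}·|ζ|·‖J‖` for supp ζ ⊂ Δ̃(y), supp J ⊂ Δ̃(y′),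
under (1.90) with constant γ₀, 0 ≤ δ, 8δ ≤ 1, (2d + 16a)δ² ≤ γ₀/2. [cite: Balaban1984PropagatorsI, (1.114) p.36 (‖ζ∇∇GJ‖), p.39 (for G₀)] -/
theorem opL2loc_four_le (hk : k ≤ P.m + P.K) (ha : 0 < a) (hm : 0 ≤ msq) (hγ : 0 < γ₀)
    (hco : ∀ f : Site P 0 → ℝ, γ₀ * (f ⬝ᵥ ((lapEta P k + 1) *ᵥ f)) ≤ f ⬝ᵥ (M0 P a msq k μ *ᵥ f))
    (hδ0 : 0 ≤ δ) (hδ8 : 8 * δ ≤ 1) (hδγ : (2 * P.d + 16 * a) * δ ^ 2 ≤ γ₀ / 2)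
    (J : Fin P.d → Site P 0 → ℝ) (ζ : Site P 0 → ℝ) (y y' : Site P k)
    (hζ : ∀ x, ζ x ≠ 0 → inCube P k x y) (hJ : ∀ ν x, J ν x ≠ 0 → inCube P k x y') :
    opL2loc P k (G0 P a msq k μ) 4 J ζ
      ≤ P.d * K4 P a γ₀ * Real.exp (2 * δ) * Real.exp (-(δ * T P k y y')) * supN P ζ * l2NormV P k J := by
  obtain ⟨hU, hUb, hb⟩ := cut_hyps hζ
  have hK := K4_nonneg (P := P) ha.le hγ
  set c := supN P ζ * K4 P a γ₀ * Real.exp (δ * (1 + 1)) * Real.exp (-(δ * T P k y y')) with hc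
  have hc0 : 0 ≤ c := by positivity
  have h : ∀ p : (Fin P.d × Fin P.d) × Fin P.d,
      nsq P (fun x => ζ x * ((dEta P k p.1.1 * dEta P k p.1.2 * G0 P a msq k μ) *ᵥ J p.2) x)
        ≤ c ^ 2 * nsq P (J p.2) := by
    intro p
    have := cut_ddG0_sq_le hk ha hm hγ hco hδ0 hδ8 hδγ y y' hb ζ (J p.2) hU hUb (hJ p.2) p.1.1 p.1.2
    simpa only [← Matrix.mulVec_mulVec, dEta_eq] using this
  have := l2Fam_le_of_nsq_le k
    (fun (p : (Fin P.d × Fin P.d) × Fin P.d) x => ζ x * ((dEta P k p.1.1 * dEta P k p.1.2 * G0 P a msq k μ) *ᵥ J p.2) x)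
    (fun p => nsq P (J p.2)) hc0 h
  have hsum : ∑ p : (Fin P.d × Fin P.d) × Fin P.d, nsq P (J p.2) = (P.d : ℝ) ^ 2 * ∑ ν, nsq P (J ν) := by
    rw [Fintype.sum_prod_type]; dsimp only
    rw [sum_const, card_univ, Fintype.card_prod, Fintype.card_fin, nsmul_eq_mul]; push_cast; ring
  have hroot : Real.sqrt ((((P.L : ℝ) ^ k)⁻¹) ^ P.d * ∑ p : (Fin P.d × Fin P.d) × Fin P.d, nsq P (J p.2))
      = P.d * l2NormV P k J := by
    rw [hsum, l2NormV_eq, mul_left_comm, Real.sqrt_mul (sq_nonneg _), Real.sqrt_sq (Nat.cast_nonneg _)]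
  rw [hroot] at this
  show l2Fam P k (fun (p : (Fin P.d × Fin P.d) × Fin P.d) x =>
      ζ x * ((dEta P k p.1.1 * dEta P k p.1.2 * G0 P a msq k μ) *ᵥ J p.2) x) ≤ _
  calc _ ≤ c * (P.d * l2NormV P k J) := this
    _ = _ := by rw [hc, exp_one_add_one']; ring

/-- **(1.114), n = 5** is `:= 0` in `B5G0SettingTorus.opL2loc` (the sixth family ‖ζG∇*∇*J‖ is not carried by the scalar
settings); recorded for the case analysis of `B5Local114G0Torus`. [cite: Balaban1984PropagatorsI, (1.114) p.36] -/
theorem opL2loc_five_eq (G : Matrix (Site P 0) (Site P 0) ℝ) (J : Fin P.d → Site P 0 → ℝ) (ζ : Site P 0 → ℝ) :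
    opL2loc P k G 5 J ζ = 0 := rfl

end Entry

end B5Local114G0Second

end

end Literature.MathematicalPhysics.QuantumFieldTheory.Balaban1983to89
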